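import Summits.AtomisticToContinuum.HydrodynamicLimit.Theorems.LambertianContactSwapLambertianEulerCollisionalInputs
import Summits.AtomisticToContinuum.HydrodynamicLimit.Theorems.LambertianContactSwapLambertianEulerJumpSumTools
import Summits.AtomisticToContinuum.HydrodynamicLimit.Theorems.LambertianContactSwapLambertianEulerKineticWindowTools
import Summits.AtomisticToContinuum.HydrodynamicLimit.Theorems.LambertianContactSwapLambertianEulerRestartInLaw
import HarnessLib

/-!
# The clamp split of the windowed jump functional of the Lambertian gas (line `Sketch`, crux stmt-11854)

Support file (`--supports stmt-AtomisticToContinuum-11854`).  Step (CLAMP-J) of lead c8's dissection of the collisional log-heart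
(`…HeartsLog.CollisionalOneBlockInMeanLambdaLog` ⇐ CCW-Λ + CAT-Λ + TL1G-Λ, `…CollisionalInputs`), the jump analogue of
`…KineticWindowTools.neg_window_le_clamp_add_remainder`: along `Λ` under local Gibbs data ⊗ noise `λ`, for a measurable jump observable
`J` dominated by the kinetic energy (`|J(t, w)| ≤ D(1 + E(w))`), a per-contact level `ℓ ≥ 0` and an overflow threshold `M ≥ 0`,
`−E_λ[Σ_{m<K_b, a<t_{m+1}} J] ≤ −E_λ[trunc_{ℓM}(Σ_{m<K_b, a<t_{m+1}} trunc_ℓ J)] + E_λ[Σ_{m<K_b, a<t_{m+1}} (|J| − ℓ)₊ + (ℓ((K_b − K_a) − M))₊]`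
(`neg_jumpSum_le_trunc_add_remainder`: the pure algebra `…JumpSumTools.abs_sub_trunc_sum_le` with the indicator count turned into
`K_b − K_a` off the null accumulation set, `indicatorCount_eq_sub`; every piece is integrable — `integrable_jumpSum` for `J` and for the excess
`(|J| − ℓ)₊`, the collision count itself being the jump sum of the constant `1`, `integrable_lambertCount_real`); the remainder expectation is
read off a `lintegral` bound of the shape CAT-Λ supplies (`integral_remainder_le_of_lintegral`); the truncated functional is trivially
`≤ ℓM` in expectation (`abs_integral_truncSum_le`, the short-interval bound).  Additivity over windows, monotonicity and the counter-term's
clamp split are in the companion `…CollisionalJumpWindows`.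

Lead prover-line-stmt-AtomisticToContinuum-11854-c8-0, 2026-08-17.  [cite: Yau1991, §2]
-/

noncomputable section

namespace Summit.AtomisticToContinuum.HydrodynamicLimit.Theorems.LambertianContactSwapLambertianEulerCollisionalClampSplit

open scoped BigOperators Topology ENNReal
open MeasureTheory ProbabilityTheory Filter Set InformationTheory
open Literature.MathematicalPhysics.KineticTheory
open Literature.Analysis.FluidPDE Literature.Analysis.FluidPDE.Alexander
open Summit.AtomisticToContinuum.HydrodynamicLimit.Theorems
open Summit.AtomisticToContinuum.HydrodynamicLimit.Theorems.LambertianContactSwapLambertianEulerCollisionalInputs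
open Summit.AtomisticToContinuum.HydrodynamicLimit.Theorems.LambertianContactSwapLambertianEulerRestartInLaw
open Summit.AtomisticToContinuum.HydrodynamicLimit.Theorems.LambertianContactSwapLambertianEulerJumpSumTools
open Summit.AtomisticToContinuum.HydrodynamicLimit.Theorems.LambertianContactSwapLambertianEulerTimeLedgerStopping

variable {σ : ℝ} {a₀ θ₀ : T3 → ℝ} {u₀ : T3 → V3} {N : ℕ}

/-! ## §1 Integrability of the collision count and of the truncated jump functional -/

/-- `trunc c` is measurable. [folklore] -/
theorem measurable_trunc (c : ℝ) : Measurable (trunc c) :=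
  measurable_const.max (measurable_const.min measurable_id)

/-- **The collision count `K_b` is `λ`-integrable** (it is the windowed jump sum of the constant `1` over `(−1, b]`, dominated by
`1 + E`; `integrable_jumpSum`). [folklore] -/
theorem integrable_lambertCount_real (hσ : 0 < σ) (hσ' : σ < 2⁻¹) (ha : Continuous a₀) (hθ : Continuous θ₀)
    (hu : Continuous u₀) (ha0 : ∀ x, 0 < a₀ x) (hθ0 : ∀ x, 0 < θ₀ x)
    (Φ : HardSphereFlow (Torus.geometry (Fin 3)) (hsDiameter σ N) (N + 1)) {b : ℝ} (hb : 0 ≤ b) :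
    Integrable (fun p : Config (N + 1) (Fin 3) T3 × (ℕ → V3) =>
      (lambertCount (Torus.geometry (Fin 3)) (hsDiameter σ N) p.2 p.1 b : ℝ))
      ((localGibbsLaw σ a₀ u₀ θ₀ N Φ).prod (lambertNoise (Fin 3))) := by
  have hdom : ∀ q : ℝ × Config (N + 1) (Fin 3) T3, |(fun _ : ℝ × Config (N + 1) (Fin 3) T3 => (1 : ℝ)) q| ≤
      1 * (1 + configEnergy q.2) := fun q => by
    have := LambertianContactSwapLambertianEulerCollisionBudget.collisionBudget_configEnergy_nonneg q.2
    rw [abs_one]; linarith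
  have hI := integrable_jumpSum hσ hσ' ha hθ hu ha0 hθ0 N Φ (J := fun _ => (1 : ℝ)) measurable_const zero_le_one hdom
    (-1) b hb
  refine hI.congr (Eventually.of_forall fun p => ?_)
  have hterm : ∀ m ∈ Finset.range (lambertCount (Torus.geometry (Fin 3)) (hsDiameter σ N) p.2 p.1 b),
      (if (-1 : ℝ) < (lambertInstant (Torus.geometry (Fin 3)) (hsDiameter σ N) p.2 p.1 (m + 1)).toReal then
        (fun _ : ℝ × Config (N + 1) (Fin 3) T3 => (1 : ℝ))
          ((lambertInstant (Torus.geometry (Fin 3)) (hsDiameter σ N) p.2 p.1 (m + 1)).toReal,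
            lambertStateAfter (Torus.geometry (Fin 3)) (hsDiameter σ N) p.2 p.1 m) else 0) = 1 := by
    intro m _
    rw [if_pos (neg_one_lt_zero.trans_le ENNReal.toReal_nonneg)]
  simp only [Finset.sum_congr rfl hterm, Finset.sum_const, Finset.card_range, nsmul_eq_mul, mul_one]

/-- **The truncated jump functional is bounded and integrable**: `|trunc_{L}(·)| ≤ L` for `L ≥ 0`, measurable by `measurable_jumpSum`.
[folklore] -/
theorem integrable_truncSum (hσ : 0 < σ) (hσ' : σ < 2⁻¹) (N : ℕ) (P : Measure (Config (N + 1) (Fin 3) T3 × (ℕ → V3)))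
    [IsFiniteMeasure P] {J : ℝ × Config (N + 1) (Fin 3) T3 → ℝ} (hJ : Measurable J) (ℓ : ℝ) {L : ℝ} (hL : 0 ≤ L) (a b : ℝ) :
    Integrable (fun p : Config (N + 1) (Fin 3) T3 × (ℕ → V3) =>
      trunc L (∑ m ∈ Finset.range (lambertCount (Torus.geometry (Fin 3)) (hsDiameter σ N) p.2 p.1 b),
        if a < (lambertInstant (Torus.geometry (Fin 3)) (hsDiameter σ N) p.2 p.1 (m + 1)).toReal then
          trunc ℓ (J ((lambertInstant (Torus.geometry (Fin 3)) (hsDiameter σ N) p.2 p.1 (m + 1)).toReal,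
            lambertStateAfter (Torus.geometry (Fin 3)) (hsDiameter σ N) p.2 p.1 m)) else 0)) P := by
  have hm := (measurable_trunc L).comp (measurable_jumpSum hσ hσ' N ((measurable_trunc ℓ).comp hJ) a b)
  refine (integrable_const L).mono' hm.aestronglyMeasurable (Eventually.of_forall fun p => ?_)
  rw [Real.norm_eq_abs]
  exact abs_trunc_le' hL _

/-- **Short-interval bound**: `|E_λ[trunc_L(·)]| ≤ L` on a probability space. [folklore] -/
theorem abs_integral_truncSum_le (N : ℕ) (P : Measure (Config (N + 1) (Fin 3) T3 × (ℕ → V3))) [IsProbabilityMeasure P]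
    (J : ℝ × Config (N + 1) (Fin 3) T3 → ℝ) (ℓ : ℝ) {L : ℝ} (hL : 0 ≤ L) (a b : ℝ) :
    |∫ p, trunc L (∑ m ∈ Finset.range (lambertCount (Torus.geometry (Fin 3)) (hsDiameter σ N) p.2 p.1 b),
        if a < (lambertInstant (Torus.geometry (Fin 3)) (hsDiameter σ N) p.2 p.1 (m + 1)).toReal then
          trunc ℓ (J ((lambertInstant (Torus.geometry (Fin 3)) (hsDiameter σ N) p.2 p.1 (m + 1)).toReal,
            lambertStateAfter (Torus.geometry (Fin 3)) (hsDiameter σ N) p.2 p.1 m)) else 0) ∂P| ≤ L := by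
  have h := norm_integral_le_of_norm_le_const (μ := P) (C := L)
    (f := fun p : Config (N + 1) (Fin 3) T3 × (ℕ → V3) =>
      trunc L (∑ m ∈ Finset.range (lambertCount (Torus.geometry (Fin 3)) (hsDiameter σ N) p.2 p.1 b),
        if a < (lambertInstant (Torus.geometry (Fin 3)) (hsDiameter σ N) p.2 p.1 (m + 1)).toReal then
          trunc ℓ (J ((lambertInstant (Torus.geometry (Fin 3)) (hsDiameter σ N) p.2 p.1 (m + 1)).toReal,
            lambertStateAfter (Torus.geometry (Fin 3)) (hsDiameter σ N) p.2 p.1 m)) else 0))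
    (Eventually.of_forall fun p => by rw [Real.norm_eq_abs]; exact abs_trunc_le' hL _)
  rwa [probReal_univ, mul_one, Real.norm_eq_abs] at h

/-! ## §2 The clamp split -/

/-- **CLAMP SPLIT OF THE JUMP FUNCTIONAL.** For a measurable energy-dominated jump observable `J`, `ℓ, M ≥ 0` and `0 ≤ a ≤ b`:
`−E_λ[Σ J] ≤ −E_λ[trunc_{ℓM}(Σ trunc_ℓ J)] + E_λ[Σ (|J| − ℓ)₊ + (ℓ((K_b − K_a) − M))₊]` along `Λ` (sums over `m < K_b` with `a < t_{m+1}`).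
[folklore] -/
theorem neg_jumpSum_le_trunc_add_remainder : ∀ {σ : ℝ} {a₀ θ₀ : T3 → ℝ} {u₀ : T3 → V3} {N : ℕ}, 0 < σ → σ < 2⁻¹ →
    Continuous a₀ → Continuous θ₀ → Continuous u₀ → (∀ x, 0 < a₀ x) → (∀ x, 0 < θ₀ x) →
    ∀ (Φ : HardSphereFlow (Torus.geometry (Fin 3)) (hsDiameter σ N) (N + 1)) {J : ℝ × Config (N + 1) (Fin 3) T3 → ℝ},
    Measurable J → ∀ {D : ℝ}, 0 ≤ D → (∀ q, |J q| ≤ D * (1 + configEnergy q.2)) →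
    ∀ {ℓ M : ℝ}, 0 ≤ ℓ → 0 ≤ M → ∀ {a b : ℝ}, 0 ≤ a → a ≤ b →
    -(∫ p, (∑ m ∈ Finset.range (lambertCount (Torus.geometry (Fin 3)) (hsDiameter σ N) p.2 p.1 b),
        if a < (lambertInstant (Torus.geometry (Fin 3)) (hsDiameter σ N) p.2 p.1 (m + 1)).toReal then
          J ((lambertInstant (Torus.geometry (Fin 3)) (hsDiameter σ N) p.2 p.1 (m + 1)).toReal,
            lambertStateAfter (Torus.geometry (Fin 3)) (hsDiameter σ N) p.2 p.1 m) else 0)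
        ∂((localGibbsLaw σ a₀ u₀ θ₀ N Φ).prod (lambertNoise (Fin 3)))) ≤
      -(∫ p, trunc (ℓ * M) (∑ m ∈ Finset.range (lambertCount (Torus.geometry (Fin 3)) (hsDiameter σ N) p.2 p.1 b),
          if a < (lambertInstant (Torus.geometry (Fin 3)) (hsDiameter σ N) p.2 p.1 (m + 1)).toReal then
            trunc ℓ (J ((lambertInstant (Torus.geometry (Fin 3)) (hsDiameter σ N) p.2 p.1 (m + 1)).toReal,
              lambertStateAfter (Torus.geometry (Fin 3)) (hsDiameter σ N) p.2 p.1 m)) else 0)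
          ∂((localGibbsLaw σ a₀ u₀ θ₀ N Φ).prod (lambertNoise (Fin 3)))) +
      ∫ p, ((∑ m ∈ Finset.range (lambertCount (Torus.geometry (Fin 3)) (hsDiameter σ N) p.2 p.1 b),
          if a < (lambertInstant (Torus.geometry (Fin 3)) (hsDiameter σ N) p.2 p.1 (m + 1)).toReal then
            max (|J ((lambertInstant (Torus.geometry (Fin 3)) (hsDiameter σ N) p.2 p.1 (m + 1)).toReal,
              lambertStateAfter (Torus.geometry (Fin 3)) (hsDiameter σ N) p.2 p.1 m)| - ℓ) 0 else 0) +
          max (ℓ * (((lambertCount (Torus.geometry (Fin 3)) (hsDiameter σ N) p.2 p.1 b : ℝ) -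
            (lambertCount (Torus.geometry (Fin 3)) (hsDiameter σ N) p.2 p.1 a : ℝ)) - M)) 0)
        ∂((localGibbsLaw σ a₀ u₀ θ₀ N Φ).prod (lambertNoise (Fin 3))) := by
  intro σ a₀ θ₀ u₀ N hσ hσ' ha₀ hθ₀ hu₀ ha₀0 hθ₀0 Φ J hJ D hD0 hD ℓ M hℓ hM a b ha hab
  have hσ2 : σ ≤ 1 / 2 := by rw [one_div]; exact hσ'.le
  haveI : IsProbabilityMeasure (localGibbsLaw σ a₀ u₀ θ₀ N Φ) :=
    isProbabilityMeasure_localGibbsLaw ha₀ hθ₀ hu₀ ha₀0 hθ₀0 hσ2 N Φ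
  set P := (localGibbsLaw σ a₀ u₀ θ₀ N Φ).prod (lambertNoise (Fin 3)) with hP
  have hb : 0 ≤ b := ha.trans hab
  have hPL : localGibbsLaw σ a₀ u₀ θ₀ N Φ ≪ liouville (Torus.geometry (Fin 3)) (N + 1) (hsDiameter σ N) := by
    rw [localGibbsLaw, particleLaw_eq]; exact withDensity_absolutelyContinuous _ _
  -- the four functionals
  set SJ : Config (N + 1) (Fin 3) T3 × (ℕ → V3) → ℝ := fun p =>
    ∑ m ∈ Finset.range (lambertCount (Torus.geometry (Fin 3)) (hsDiameter σ N) p.2 p.1 b),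
        if a < (lambertInstant (Torus.geometry (Fin 3)) (hsDiameter σ N) p.2 p.1 (m + 1)).toReal then
          J ((lambertInstant (Torus.geometry (Fin 3)) (hsDiameter σ N) p.2 p.1 (m + 1)).toReal,
            lambertStateAfter (Torus.geometry (Fin 3)) (hsDiameter σ N) p.2 p.1 m) else 0 with hSJ
  set TL : Config (N + 1) (Fin 3) T3 × (ℕ → V3) → ℝ := fun p =>
    trunc (ℓ * M) (∑ m ∈ Finset.range (lambertCount (Torus.geometry (Fin 3)) (hsDiameter σ N) p.2 p.1 b),
          if a < (lambertInstant (Torus.geometry (Fin 3)) (hsDiameter σ N) p.2 p.1 (m + 1)).toReal then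
            trunc ℓ (J ((lambertInstant (Torus.geometry (Fin 3)) (hsDiameter σ N) p.2 p.1 (m + 1)).toReal,
              lambertStateAfter (Torus.geometry (Fin 3)) (hsDiameter σ N) p.2 p.1 m)) else 0) with hTL
  set R1 : Config (N + 1) (Fin 3) T3 × (ℕ → V3) → ℝ := fun p =>
    ∑ m ∈ Finset.range (lambertCount (Torus.geometry (Fin 3)) (hsDiameter σ N) p.2 p.1 b),
          if a < (lambertInstant (Torus.geometry (Fin 3)) (hsDiameter σ N) p.2 p.1 (m + 1)).toReal then
            max (|J ((lambertInstant (Torus.geometry (Fin 3)) (hsDiameter σ N) p.2 p.1 (m + 1)).toReal,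
              lambertStateAfter (Torus.geometry (Fin 3)) (hsDiameter σ N) p.2 p.1 m)| - ℓ) 0 else 0 with hR1
  set R2 : Config (N + 1) (Fin 3) T3 × (ℕ → V3) → ℝ := fun p =>
    max (ℓ * (((lambertCount (Torus.geometry (Fin 3)) (hsDiameter σ N) p.2 p.1 b : ℝ) -
            (lambertCount (Torus.geometry (Fin 3)) (hsDiameter σ N) p.2 p.1 a : ℝ)) - M)) 0 with hR2
  -- integrability
  have hIJ : Integrable SJ P := integrable_jumpSum hσ hσ' ha₀ hθ₀ hu₀ ha₀0 hθ₀0 N Φ hJ hD0 hD a b hb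
  have hITL : Integrable TL P := integrable_truncSum hσ hσ' N P hJ ℓ (mul_nonneg hℓ hM) a b
  have hJexc : Measurable fun q : ℝ × Config (N + 1) (Fin 3) T3 => max (|J q| - ℓ) 0 :=
    ((measurable_abs.comp hJ).sub measurable_const).max measurable_const
  have hJexcD : ∀ q : ℝ × Config (N + 1) (Fin 3) T3, |max (|J q| - ℓ) 0| ≤ D * (1 + configEnergy q.2) := by
    intro q
    rw [abs_of_nonneg (le_max_right _ _)]
    exact (max_le (by linarith [abs_nonneg (J q)]) (abs_nonneg _)).trans (hD q)
  have hIR1 : Integrable R1 P := integrable_jumpSum hσ hσ' ha₀ hθ₀ hu₀ ha₀0 hθ₀0 N Φ hJexc hD0 hJexcD a b hb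
  have hKb := integrable_lambertCount_real hσ hσ' ha₀ hθ₀ hu₀ ha₀0 hθ₀0 Φ hb
  have hKa := integrable_lambertCount_real hσ hσ' ha₀ hθ₀ hu₀ ha₀0 hθ₀0 Φ ha
  have hIR2 : Integrable R2 P := by
    have hlin : Integrable (fun p : Config (N + 1) (Fin 3) T3 × (ℕ → V3) =>
        ℓ * (((lambertCount (Torus.geometry (Fin 3)) (hsDiameter σ N) p.2 p.1 b : ℝ) -
            (lambertCount (Torus.geometry (Fin 3)) (hsDiameter σ N) p.2 p.1 a : ℝ)) - M)) P :=
      ((hKb.sub hKa).sub (integrable_const M)).const_mul ℓ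
    refine hlin.abs.mono' (hlin.aestronglyMeasurable.aemeasurable.max aemeasurable_const).aestronglyMeasurable
      (Eventually.of_forall fun p => ?_)
    rw [Real.norm_eq_abs, abs_of_nonneg (le_max_right _ _)]
    exact max_le (le_abs_self _) (abs_nonneg _)
  -- pathwise, off the accumulation set
  have hacc : ∀ᵐ p ∂P, ∃ k, ENNReal.ofReal b < lambertInstant (Torus.geometry (Fin 3)) (hsDiameter σ N) p.2 p.1 k := by
    filter_upwards [ae_nonAccumulation_of_absolutelyContinuous hσ hσ' N _ hPL] with p hp using hp b
  have hpath : ∀ᵐ p ∂P, |SJ p - TL p| ≤ R1 p + R2 p := by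
    filter_upwards [hacc] with p hp
    have h1 := abs_sub_trunc_sum_le (lambertCount (Torus.geometry (Fin 3)) (hsDiameter σ N) p.2 p.1 b)
      (fun m => a < (lambertInstant (Torus.geometry (Fin 3)) (hsDiameter σ N) p.2 p.1 (m + 1)).toReal)
      (fun m => J ((lambertInstant (Torus.geometry (Fin 3)) (hsDiameter σ N) p.2 p.1 (m + 1)).toReal,
        lambertStateAfter (Torus.geometry (Fin 3)) (hsDiameter σ N) p.2 p.1 m)) hℓ M
    rw [indicatorCount_eq_sub ha hab hp] at h1
    simpa only [hSJ, hTL, hR1, hR2, trunc] using h1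
  -- assembling
  have hsplit : ∫ p, SJ p ∂P = (∫ p, TL p ∂P) + ∫ p, (SJ p - TL p) ∂P := by
    rw [integral_sub hIJ hITL]; ring
  have hdiff : -(∫ p, (SJ p - TL p) ∂P) ≤ ∫ p, (R1 p + R2 p) ∂P :=
    calc -(∫ p, (SJ p - TL p) ∂P) ≤ |∫ p, (SJ p - TL p) ∂P| := neg_le_abs _
      _ ≤ ∫ p, |SJ p - TL p| ∂P := abs_integral_le_integral_abs
      _ ≤ ∫ p, (R1 p + R2 p) ∂P := integral_mono_ae (hIJ.sub hITL).abs (hIR1.add hIR2) hpath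
  show -(∫ p, SJ p ∂P) ≤ -(∫ p, TL p ∂P) + ∫ p, (R1 p + R2 p) ∂P
  linarith

/-- **The remainder expectation from a `lintegral` bound** (the shape of CAT-Λ): if
`∫⁻ ofReal(Σ (|J| − ℓ)₊) + ∫⁻ ofReal(ℓ((K_b − K_a) − M)) ≤ ofReal B` then `E_λ[Σ (|J| − ℓ)₊ + (ℓ((K_b − K_a) − M))₊] ≤ B`. [folklore] -/
theorem integral_remainder_le_of_lintegral (hσ : 0 < σ) (hσ' : σ < 2⁻¹) (ha₀ : Continuous a₀) (hθ₀ : Continuous θ₀)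
    (hu₀ : Continuous u₀) (ha₀0 : ∀ x, 0 < a₀ x) (hθ₀0 : ∀ x, 0 < θ₀ x)
    (Φ : HardSphereFlow (Torus.geometry (Fin 3)) (hsDiameter σ N) (N + 1)) {J : ℝ × Config (N + 1) (Fin 3) T3 → ℝ}
    (hJ : Measurable J) {D : ℝ} (hD0 : 0 ≤ D) (hD : ∀ q, |J q| ≤ D * (1 + configEnergy q.2))
    {ℓ : ℝ} (hℓ : 0 ≤ ℓ) (M : ℝ) {a b : ℝ} (ha : 0 ≤ a) (hab : a ≤ b) {B : ℝ} (hB : 0 ≤ B)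
    (hle : (∫⁻ p, ENNReal.ofReal (∑ m ∈ Finset.range (lambertCount (Torus.geometry (Fin 3)) (hsDiameter σ N) p.2 p.1 b),
          if a < (lambertInstant (Torus.geometry (Fin 3)) (hsDiameter σ N) p.2 p.1 (m + 1)).toReal then
            max (|J ((lambertInstant (Torus.geometry (Fin 3)) (hsDiameter σ N) p.2 p.1 (m + 1)).toReal,
              lambertStateAfter (Torus.geometry (Fin 3)) (hsDiameter σ N) p.2 p.1 m)| - ℓ) 0 else 0)
          ∂((localGibbsLaw σ a₀ u₀ θ₀ N Φ).prod (lambertNoise (Fin 3)))) +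
        (∫⁻ p, ENNReal.ofReal (ℓ * (((lambertCount (Torus.geometry (Fin 3)) (hsDiameter σ N) p.2 p.1 b : ℝ) -
            (lambertCount (Torus.geometry (Fin 3)) (hsDiameter σ N) p.2 p.1 a : ℝ)) - M))
          ∂((localGibbsLaw σ a₀ u₀ θ₀ N Φ).prod (lambertNoise (Fin 3)))) ≤ ENNReal.ofReal B) :
    ∫ p, ((∑ m ∈ Finset.range (lambertCount (Torus.geometry (Fin 3)) (hsDiameter σ N) p.2 p.1 b),
          if a < (lambertInstant (Torus.geometry (Fin 3)) (hsDiameter σ N) p.2 p.1 (m + 1)).toReal then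
            max (|J ((lambertInstant (Torus.geometry (Fin 3)) (hsDiameter σ N) p.2 p.1 (m + 1)).toReal,
              lambertStateAfter (Torus.geometry (Fin 3)) (hsDiameter σ N) p.2 p.1 m)| - ℓ) 0 else 0) +
          max (ℓ * (((lambertCount (Torus.geometry (Fin 3)) (hsDiameter σ N) p.2 p.1 b : ℝ) -
            (lambertCount (Torus.geometry (Fin 3)) (hsDiameter σ N) p.2 p.1 a : ℝ)) - M)) 0)
        ∂((localGibbsLaw σ a₀ u₀ θ₀ N Φ).prod (lambertNoise (Fin 3))) ≤ B := by
  have hσ2 : σ ≤ 1 / 2 := by rw [one_div]; exact hσ'.le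
  haveI : IsProbabilityMeasure (localGibbsLaw σ a₀ u₀ θ₀ N Φ) :=
    isProbabilityMeasure_localGibbsLaw ha₀ hθ₀ hu₀ ha₀0 hθ₀0 hσ2 N Φ
  set P := (localGibbsLaw σ a₀ u₀ θ₀ N Φ).prod (lambertNoise (Fin 3)) with hP
  have hb : 0 ≤ b := ha.trans hab
  set R1 : Config (N + 1) (Fin 3) T3 × (ℕ → V3) → ℝ := fun p =>
    ∑ m ∈ Finset.range (lambertCount (Torus.geometry (Fin 3)) (hsDiameter σ N) p.2 p.1 b),
          if a < (lambertInstant (Torus.geometry (Fin 3)) (hsDiameter σ N) p.2 p.1 (m + 1)).toReal then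
            max (|J ((lambertInstant (Torus.geometry (Fin 3)) (hsDiameter σ N) p.2 p.1 (m + 1)).toReal,
              lambertStateAfter (Torus.geometry (Fin 3)) (hsDiameter σ N) p.2 p.1 m)| - ℓ) 0 else 0 with hR1
  set g : Config (N + 1) (Fin 3) T3 × (ℕ → V3) → ℝ := fun p =>
    ℓ * (((lambertCount (Torus.geometry (Fin 3)) (hsDiameter σ N) p.2 p.1 b : ℝ) -
            (lambertCount (Torus.geometry (Fin 3)) (hsDiameter σ N) p.2 p.1 a : ℝ)) - M) with hg
  have hJexc : Measurable fun q : ℝ × Config (N + 1) (Fin 3) T3 => max (|J q| - ℓ) 0 :=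
    ((measurable_abs.comp hJ).sub measurable_const).max measurable_const
  have hJexcD : ∀ q : ℝ × Config (N + 1) (Fin 3) T3, |max (|J q| - ℓ) 0| ≤ D * (1 + configEnergy q.2) := by
    intro q
    rw [abs_of_nonneg (le_max_right _ _)]
    exact (max_le (by linarith [abs_nonneg (J q)]) (abs_nonneg _)).trans (hD q)
  have hIR1 : Integrable R1 P := integrable_jumpSum hσ hσ' ha₀ hθ₀ hu₀ ha₀0 hθ₀0 N Φ hJexc hD0 hJexcD a b hb
  have hKb := integrable_lambertCount_real hσ hσ' ha₀ hθ₀ hu₀ ha₀0 hθ₀0 Φ hb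
  have hKa := integrable_lambertCount_real hσ hσ' ha₀ hθ₀ hu₀ ha₀0 hθ₀0 Φ ha
  have hIg : Integrable g P := ((hKb.sub hKa).sub (integrable_const M)).const_mul ℓ
  have hIg' : Integrable (fun p => max (g p) 0) P := by
    refine hIg.abs.mono' (hIg.aestronglyMeasurable.aemeasurable.max aemeasurable_const).aestronglyMeasurable
      (Eventually.of_forall fun p => ?_)
    rw [Real.norm_eq_abs, abs_of_nonneg (le_max_right _ _)]
    exact max_le (le_abs_self _) (abs_nonneg _)
  have hR10 : ∀ p, 0 ≤ R1 p := fun p => Finset.sum_nonneg fun m _ => by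
    split_ifs
    · exact le_max_right _ _
    · exact le_rfl
  -- the two Bochner integrals as lintegrals
  have h1 : ∫ p, R1 p ∂P = (∫⁻ p, ENNReal.ofReal (R1 p) ∂P).toReal :=
    integral_eq_lintegral_of_nonneg_ae (Eventually.of_forall hR10) hIR1.aestronglyMeasurable
  have h2 : ∫ p, max (g p) 0 ∂P = (∫⁻ p, ENNReal.ofReal (g p) ∂P).toReal := by
    rw [integral_eq_lintegral_of_nonneg_ae (f := fun p => max (g p) 0) (Eventually.of_forall fun p => le_max_right (g p) 0)
      hIg'.aestronglyMeasurable]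
    congr 1
    refine lintegral_congr fun p => ?_
    rw [ENNReal.ofReal_max, ENNReal.ofReal_zero]
    exact max_eq_left bot_le
  have hfin1 : ∫⁻ p, ENNReal.ofReal (R1 p) ∂P ≠ ⊤ :=
    ne_top_of_le_ne_top ENNReal.ofReal_ne_top ((le_add_right le_rfl).trans hle)
  have hfin2 : ∫⁻ p, ENNReal.ofReal (g p) ∂P ≠ ⊤ :=
    ne_top_of_le_ne_top ENNReal.ofReal_ne_top ((le_add_left le_rfl).trans hle)
  show ∫ p, (R1 p + max (g p) 0) ∂P ≤ B
  rw [integral_add hIR1 hIg', h1, h2, ← ENNReal.toReal_add hfin1 hfin2, ← ENNReal.toReal_ofReal hB]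
  exact ENNReal.toReal_mono ENNReal.ofReal_ne_top hle

end Summit.AtomisticToContinuum.HydrodynamicLimit.Theorems.LambertianContactSwapLambertianEulerCollisionalClampSplit
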